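import Summits.CriticalPhenomena.Ising3DConformalLimit.Theses.SubPtolemyInterlacing
import Summits.CriticalPhenomena.Ising3DConformalLimit.Theorems.SubPtolemyInterlacingSubPtolemyFloorCertificates
import Summits.CriticalPhenomena.Ising3DConformalLimit.Theorems.SubPtolemyInterlacingSubPtolemyFloorSteinCovariance
import Summits.CriticalPhenomena.Ising3DConformalLimit.Theorems.SubPtolemyInterlacingSubPtolemyFloorPlusCauchySchwarz
import Literature.Probability.LatticeModels.CriticalBlockMoments
import Mathlib.Analysis.SpecialFunctions.Pow.Asymptotics
import HarnessLib

/-!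
# `SubPtolemyFloor` ⇐ Stein witnesses: the Cramér–Rao floor with the DLR score and the certificate of
# the line `Sketch` (= crux idea `stein-cramer-rao-dual-witness`), crux stmt-CriticalPhenomena-15703

Route decl `Summit.CriticalPhenomena.Ising3DConformalLimit.Theses.SubPtolemyInterlacing.SubPtolemyFloor`
(axial floor `⟨σ₀σ_{ne₁}⟩⁺_{β_c(3)} ≥ c n^{-a}`, `a < L := log₂(1+√2)`; open problem). Checked skeleton
`Cruxes/SubPtolemyFloor/Lines/Sketch.lean` (lead c4); this file is its glue, landed.

Notation (everything UNFOLDED in tree vocabulary — the line posits no definition): `β = criticalBeta 3`,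
`⟨·⟩ = plusExpect 3 β 0`, `G = criticalTwoPoint 3`, `Λ_N = box 3 N`,
`S_x σ = ∑ y ∈ (zdGraph 3).neighborFinset x, spinAt y σ`, `t_x = tanh(β S_x)`, the DLR SCORE
`g_x = σ_x − t_x`, a local functional `A` reading the finite `K ∌ 0`, `A_x σ = A (fun y => σ (y + x))`,
the STEIN FIELD `Ψ^A_x = A_x g_x`, its coupling `c_A = ⟨A (1 − t_0²)⟩`, block variance
`V_A(N) = ⟨(Σ_{x∈Λ_N} Ψ^A_x)²⟩`, pair sum `B(N) = Σ_{x,y∈Λ_N} G(y−x) = ⟨M_N²⟩` (`M_N = Σ_{x∈Λ_N} σ_x`).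

Contents:
* `cramerRaoFloor` — **the Cramér–Rao floor with a Stein witness** (card Lemma 2):
  `(|Λ_N| c_A)² ≤ B(N) · V_A(N)` for every local `A` not reading `σ_0` and every `N`; from the landed
  stubs `stub_steinCovariance` (`⟨M_N Σ_xΨ^A_x⟩ = |Λ_N| c_A`: heat-bath/DLR + translation invariance,
  p148306) and `stub_plusCauchySchwarz` (p149771), and `⟨M_N²⟩ = B(N)` (`plusExpect_blockSpin_sq_eq_sum`).
  A LOWER bound on the critical two-point mass certified by ONE explicit local functional.
* `boxPairFloor_of_steinWitness` — witnesses with `V_A(r) ≤ C |Λ_r| r^{-b} c_A²` at every scale give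
  `B(r) ≥ C⁻¹ r^{3+b}`.
* `subPtolemyFloor_of_steinWitness` — **the line's certificate**: such witnesses with
  `b ∈ (3 − 3L/(2+L), 2]` (`= (1.834, 2]`) give `SubPtolemyFloor` BY NAME, through the landed
  `SubPtolemyFloorSketch.stub_susceptibilityFloorOfBoxPairFloor` (p129162) and certificate C1
  `SubPtolemyFloorSketch.stub_cruxOfSusceptibilityFloor` (p129874, `a₀ = 3 − b`).
* `subPtolemyFloor_of_steinWitness_of_doubling` — the crux-exact branch: with axial doubling
  `G(2n e₁) ≥ κ G(n e₁)`, `κ > 1/8`, witnesses with `b > 3 − L` (`= 1.728`) suffice (certificate C2).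
* `steinWitness_false_of_two_lt` — the window: witnesses with `b > 2` do not exist (Cramér–Rao floor
  against the infrared bound `B(r) ≤ K r⁵`, `pairSum_le_rpow_five`), so the engine is asked exactly on
  `(1.834, 2]` (truth conjecturally `b = 2 − η = 1.964`).

The antecedent (the registered engine stub `stub_steinWitness`) is OPEN; these are CONDITIONAL
closings of the crux (`proof.conditional`), landed `--supports`. No definitions, no named facts.

References: the card `Cruxes/SubPtolemyFloor/Ideas/stein-cramer-rao-dual-witness-v2.md`; C. Stein,
Proc. Sixth Berkeley Symp. (1972) (method); S. Friedli, Y. Velenik (CUP 2017) Lemma 6.7 (heat bath).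
-/

noncomputable section

namespace Summit.CriticalPhenomena.Ising3DConformalLimit.SubPtolemyFloorStein

open scoped BigOperators Classical
open Finset MeasureTheory Literature.Probability.LatticeModels
open Summit.CriticalPhenomena.Ising3DConformalLimit.Theses.SubPtolemyInterlacing

/-! ### `DependsOn` bookkeeping for the block spin and the Stein sum -/

/-- A finite sum of functionals each depending on the spins in `D` depends on the spins in `D`. [folklore] -/
theorem dependsOn_finset_sum {ι : Type*} (s : Finset ι) {D : Set (Site 3)}
    {F : ι → SpinConfig (Site 3) → ℝ} (hF : ∀ i ∈ s, DependsOn (F i) D) :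
    DependsOn (fun σ => ∑ i ∈ s, F i σ) D :=
  fun _ _ h => Finset.sum_congr rfl fun i hi => hF i hi h

/-- The block spin `M_N = Σ_{x∈Λ_N} σ_x` depends on the spins in `Λ_N`. [folklore] -/
theorem dependsOn_blockSpin (N : ℕ) :
    DependsOn (fun σ : SpinConfig (Site 3) => ∑ x ∈ box 3 N, spinAt x σ) (↑(box 3 N) : Set (Site 3)) :=
  dependsOn_finset_sum _ fun x hx _ _ h => by simp only [spinAt, h x (by simpa using hx)]

/-- The Stein sum `Σ_{x∈Λ_N} Ψ^A_x` depends on the spins at the sites `x ∈ Λ_N`, their neighbours and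
`K + x`. [folklore] -/
theorem dependsOn_steinSum (K : Finset (Site 3)) (A : SpinConfig (Site 3) → ℝ)
    (hA : DependsOn A (↑K : Set (Site 3))) (N : ℕ) :
    DependsOn (fun σ : SpinConfig (Site 3) => ∑ x ∈ box 3 N, A (fun y => σ (y + x)) *
        (spinAt x σ - Real.tanh (criticalBeta 3 * ∑ y ∈ (zdGraph 3).neighborFinset x, spinAt y σ)))
      (↑((box 3 N).biUnion fun x => insert x ((zdGraph 3).neighborFinset x ∪ K.image (· + x))) :
        Set (Site 3)) := by
  refine dependsOn_finset_sum _ fun x hx σ τ h => ?_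
  have hmem : ∀ y, y ∈ insert x ((zdGraph 3).neighborFinset x ∪ K.image (· + x)) →
      y ∈ (↑((box 3 N).biUnion fun x => insert x ((zdGraph 3).neighborFinset x ∪ K.image (· + x))) :
        Set (Site 3)) := fun y hy => by
    simp only [coe_biUnion, Set.mem_iUnion, mem_coe]
    exact ⟨x, hx, hy⟩
  have h1 : A (fun y => σ (y + x)) = A (fun y => τ (y + x)) :=
    hA fun y hy => h _ (hmem _ (mem_insert_of_mem (mem_union_right _ (mem_image_of_mem _ hy))))
  have h2 : spinAt x σ = spinAt x τ := by
    simp only [spinAt, h x (hmem x (mem_insert_self _ _))]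
  have h3 : ∑ y ∈ (zdGraph 3).neighborFinset x, spinAt y σ =
      ∑ y ∈ (zdGraph 3).neighborFinset x, spinAt y τ :=
    Finset.sum_congr rfl fun y hy => by
      simp only [spinAt, h y (hmem y (mem_insert_of_mem (mem_union_left _ hy)))]
  rw [h1, h2, h3]

/-! ### The Cramér–Rao floor -/

/-- **Cramér–Rao floor with a Stein witness** (card Lemma 2). For every local functional `A` not
reading `σ_0` (`A` depends on the spins in a finite `K ∌ 0`) and every `N`,
`(|Λ_N| · c_A)² ≤ B(N) · V_A(N)`, where `c_A = ⟨A(1 − t_0²)⟩` is the Stein coupling,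
`V_A(N) = ⟨(Σ_{x∈Λ_N} A_x g_x)²⟩` the block second moment of the Stein field and
`B(N) = Σ_{x,y∈Λ_N} ⟨σ₀σ_{y−x}⟩_{β_c} = ⟨M_N²⟩`: Cauchy–Schwarz `⟨M_N Σ_xΨ^A_x⟩² ≤ ⟨M_N²⟩⟨(Σ_xΨ^A_x)²⟩`
and the covariance identity `⟨M_N Σ_xΨ^A_x⟩ = |Λ_N| c_A` (stubs `stub_plusCauchySchwarz`,
`stub_steinCovariance`). A certified LOWER bound on the critical two-point mass from ONE explicit
local functional. [folklore] -/
theorem cramerRaoFloor (K : Finset (Site 3)) (A : SpinConfig (Site 3) → ℝ) (hK : (0 : Site 3) ∉ K)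
    (hA : DependsOn A (↑K : Set (Site 3))) (N : ℕ) :
    ((#(box 3 N) : ℝ) * plusExpect 3 (criticalBeta 3) 0 (fun σ => A σ *
        (1 - Real.tanh (criticalBeta 3 * ∑ y ∈ (zdGraph 3).neighborFinset 0, spinAt y σ) ^ 2))) ^ 2 ≤
      (∑ x ∈ box 3 N, ∑ y ∈ box 3 N, criticalTwoPoint 3 (y - x)) *
        plusExpect 3 (criticalBeta 3) 0 (fun σ => (∑ x ∈ box 3 N, A (fun y => σ (y + x)) *
          (spinAt x σ - Real.tanh (criticalBeta 3 *
            ∑ y ∈ (zdGraph 3).neighborFinset x, spinAt y σ))) ^ 2) := by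
  have h1 := stub_steinCovariance K A hK hA N
  have h2 := stub_plusCauchySchwarz 3 (criticalBeta 3) (criticalBeta_nonneg 3) (box 3 N)
    ((box 3 N).biUnion fun x => insert x ((zdGraph 3).neighborFinset x ∪ K.image (· + x))) _ _
    (dependsOn_blockSpin N) (dependsOn_steinSum K A hA N)
  have h3 : plusExpect 3 (criticalBeta 3) 0 (fun σ => (∑ x ∈ box 3 N, spinAt x σ) ^ 2) =
      ∑ x ∈ box 3 N, ∑ y ∈ box 3 N, criticalTwoPoint 3 (y - x) := by
    rw [plusExpect_blockSpin_sq_eq_sum]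
    exact Finset.sum_congr rfl fun a _ => Finset.sum_congr rfl fun b _ => criticalCorr_two_pair a b
  rw [h1, h3] at h2
  exact h2

/-! ### Transfer: Stein witnesses ⇒ pair-sum floor ⇒ the crux -/

/-- `|Λ_r| = (2r+1)³ ≥ r³` as reals. [folklore] -/
theorem rpow_three_le_card_box (r : ℕ) : (r : ℝ) ^ (3 : ℝ) ≤ (#(box 3 r) : ℝ) := by
  rw [card_box, show (3 : ℝ) = ((3 : ℕ) : ℝ) by norm_num, Real.rpow_natCast]
  push_cast
  have hr : (0 : ℝ) ≤ r := Nat.cast_nonneg r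
  exact pow_le_pow_left₀ hr (show (r : ℝ) ≤ 2 * r + 1 by linarith) 3

/-- **Stein witnesses ⇒ pair-sum floor.** If at every scale `r ≥ 1` there is a local `A` (not reading
`σ_0`) with coupling `c_A > 0` and block variance `V_A(r) ≤ C |Λ_r| r^{-b} c_A²`, then
`B(r) = Σ_{x,y∈Λ_r} G(y−x) ≥ C⁻¹ r^{3+b}` for all `r ≥ 1` (Cramér–Rao floor, divide, `|Λ_r| ≥ r³`). [folklore] -/
theorem boxPairFloor_of_steinWitness {b C : ℝ} (hC : 0 < C)
    (hW : ∀ r : ℕ, 1 ≤ r → ∃ (K : Finset (Site 3)) (A : SpinConfig (Site 3) → ℝ),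
        (0 : Site 3) ∉ K ∧ DependsOn A (↑K : Set (Site 3)) ∧
        0 < plusExpect 3 (criticalBeta 3) 0 (fun σ => A σ *
            (1 - Real.tanh (criticalBeta 3 * ∑ y ∈ (zdGraph 3).neighborFinset 0, spinAt y σ) ^ 2)) ∧
        plusExpect 3 (criticalBeta 3) 0 (fun σ => (∑ x ∈ box 3 r, A (fun y => σ (y + x)) *
            (spinAt x σ - Real.tanh (criticalBeta 3 *
              ∑ y ∈ (zdGraph 3).neighborFinset x, spinAt y σ))) ^ 2) ≤
          C * (#(box 3 r) : ℝ) * (r : ℝ) ^ (-b) *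
            plusExpect 3 (criticalBeta 3) 0 (fun σ => A σ *
              (1 - Real.tanh (criticalBeta 3 *
                ∑ y ∈ (zdGraph 3).neighborFinset 0, spinAt y σ) ^ 2)) ^ 2) :
    ∃ c : ℝ, 0 < c ∧ ∀ n : ℕ, 1 ≤ n →
      c * (n : ℝ) ^ (3 + b) ≤ ∑ x ∈ box 3 n, ∑ y ∈ box 3 n, criticalTwoPoint 3 (y - x) := by
  refine ⟨C⁻¹, inv_pos.2 hC, fun r hr => ?_⟩
  obtain ⟨K, A, hK, hA, hcA, hV⟩ := hW r hr
  set cA := plusExpect 3 (criticalBeta 3) 0 (fun σ => A σ *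
    (1 - Real.tanh (criticalBeta 3 * ∑ y ∈ (zdGraph 3).neighborFinset 0, spinAt y σ) ^ 2)) with hcAdef
  set V := plusExpect 3 (criticalBeta 3) 0 (fun σ => (∑ x ∈ box 3 r, A (fun y => σ (y + x)) *
    (spinAt x σ - Real.tanh (criticalBeta 3 *
      ∑ y ∈ (zdGraph 3).neighborFinset x, spinAt y σ))) ^ 2) with hVdef
  set B := ∑ x ∈ box 3 r, ∑ y ∈ box 3 r, criticalTwoPoint 3 (y - x) with hBdef
  set Λ : ℝ := (#(box 3 r) : ℝ) with hΛdef
  have hCR : (Λ * cA) ^ 2 ≤ B * V := cramerRaoFloor K A hK hA r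
  have hr0 : (0 : ℝ) < r := Nat.cast_pos.2 hr
  have hΛpos : 0 < Λ := by
    rw [hΛdef, card_box]; positivity
  have hB0 : 0 ≤ B := Finset.sum_nonneg fun x _ => Finset.sum_nonneg fun y _ => criticalTwoPoint_nonneg' _
  have hrb : 0 < (r : ℝ) ^ (-b) := Real.rpow_pos_of_pos hr0 _
  have hkey : (Λ * cA) ^ 2 ≤ B * (C * Λ * (r : ℝ) ^ (-b) * cA ^ 2) :=
    hCR.trans (mul_le_mul_of_nonneg_left hV hB0)
  have hΛB : Λ * ((r : ℝ) ^ (-b))⁻¹ ≤ C * B := by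
    have h1 : Λ ^ 2 * cA ^ 2 ≤ B * C * Λ * (r : ℝ) ^ (-b) * cA ^ 2 := by nlinarith [hkey]
    have h2 : Λ ≤ B * C * (r : ℝ) ^ (-b) := by
      have hpos : 0 < Λ * cA ^ 2 := by positivity
      nlinarith [h1, hpos]
    calc Λ * ((r : ℝ) ^ (-b))⁻¹ ≤ B * C * (r : ℝ) ^ (-b) * ((r : ℝ) ^ (-b))⁻¹ :=
          mul_le_mul_of_nonneg_right h2 (inv_nonneg.2 hrb.le)
      _ = C * B := by field_simp
  have hpow : (r : ℝ) ^ (3 + b) ≤ Λ * ((r : ℝ) ^ (-b))⁻¹ := by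
    rw [Real.rpow_add hr0, Real.rpow_neg hr0.le, inv_inv]
    exact mul_le_mul_of_nonneg_right (rpow_three_le_card_box r) (Real.rpow_nonneg hr0.le _)
  calc C⁻¹ * (r : ℝ) ^ (3 + b) ≤ C⁻¹ * (C * B) :=
        mul_le_mul_of_nonneg_left (hpow.trans hΛB) (inv_nonneg.2 hC.le)
    _ = B := by field_simp

/-- `0 ≤ 3 − 3L/(2+L)` for `L = log₂(1+√2)` (indeed `3L/(2+L) < 3`). [folklore] -/
theorem three_sub_threshold_nonneg :
    (0 : ℝ) ≤ 3 - 3 * Real.logb 2 (1 + Real.sqrt 2) / (2 + Real.logb 2 (1 + Real.sqrt 2)) := by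
  have hL := SubPtolemyFloorSketch.ptolemyExp_pos
  have h3 : 3 * Real.logb 2 (1 + Real.sqrt 2) / (2 + Real.logb 2 (1 + Real.sqrt 2)) ≤ 3 := by
    rw [div_le_iff₀ (by linarith)]; nlinarith
  linarith

/-- **The certificate of the line `Sketch` (stein-cramer-rao-dual-witness): Stein witnesses with
exponent `b ∈ (3 − 3L/(2+L), 2]` give the crux.** If for some `b` with `3 − 3L/(2+L) < b ≤ 2`
(`L = log₂(1+√2)`; window `(1.834, 2]`) and `C > 0`, at every scale `r ≥ 1` there is a local functional
`A` not reading `σ_0` with `c_A > 0` and `V_A(r) ≤ C |Λ_r| r^{-b} c_A²`, then `SubPtolemyFloor` holds: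
pair-sum floor `B(r) ≥ C⁻¹ r^{3+b}` (`boxPairFloor_of_steinWitness`) ⇒ susceptibility floor
`χ_n ≥ c n^{b}` (`SubPtolemyFloorSketch.stub_susceptibilityFloorOfBoxPairFloor`) ⇒ the crux with
`a₀ = 3 − b ∈ [1, 3L/(2+L))` (certificate C1 `SubPtolemyFloorSketch.stub_cruxOfSusceptibilityFloor`).
The antecedent is the registered engine stub `stub_steinWitness` (OPEN): a CONDITIONAL closing. [folklore] -/
theorem subPtolemyFloor_of_steinWitness {b C : ℝ}
    (hb : 3 - 3 * Real.logb 2 (1 + Real.sqrt 2) / (2 + Real.logb 2 (1 + Real.sqrt 2)) < b)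
    (hb2 : b ≤ 2) (hC : 0 < C)
    (hW : ∀ r : ℕ, 1 ≤ r → ∃ (K : Finset (Site 3)) (A : SpinConfig (Site 3) → ℝ),
        (0 : Site 3) ∉ K ∧ DependsOn A (↑K : Set (Site 3)) ∧
        0 < plusExpect 3 (criticalBeta 3) 0 (fun σ => A σ *
            (1 - Real.tanh (criticalBeta 3 * ∑ y ∈ (zdGraph 3).neighborFinset 0, spinAt y σ) ^ 2)) ∧
        plusExpect 3 (criticalBeta 3) 0 (fun σ => (∑ x ∈ box 3 r, A (fun y => σ (y + x)) *
            (spinAt x σ - Real.tanh (criticalBeta 3 *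
              ∑ y ∈ (zdGraph 3).neighborFinset x, spinAt y σ))) ^ 2) ≤
          C * (#(box 3 r) : ℝ) * (r : ℝ) ^ (-b) *
            plusExpect 3 (criticalBeta 3) 0 (fun σ => A σ *
              (1 - Real.tanh (criticalBeta 3 *
                ∑ y ∈ (zdGraph 3).neighborFinset 0, spinAt y σ) ^ 2)) ^ 2) :
    SubPtolemyFloor := by
  obtain ⟨c, hc, hB⟩ := boxPairFloor_of_steinWitness hC hW
  have hs : (3 : ℝ) ≤ 3 + b := by linarith [three_sub_threshold_nonneg]
  obtain ⟨c', hc', hS⟩ :=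
    SubPtolemyFloorSketch.stub_susceptibilityFloorOfBoxPairFloor (3 + b) hs ⟨c, hc, hB⟩
  refine SubPtolemyFloorSketch.stub_cruxOfSusceptibilityFloor ⟨3 - b, by linarith, by linarith, c', hc', ?_⟩
  intro n hn
  have h := hS n hn
  have he : (3 : ℝ) - (6 - (3 + b)) = 3 - (3 - b) := by ring
  rw [he] at h
  exact h

/-- **Registered certificate stub `stub_cruxOfSteinWitness`: the engine statement (verbatim the
registered engine stub `stub_steinWitness` of the skeleton `Lines/Sketch.lean`) implies the crux.**
Pure repackaging of `subPtolemyFloor_of_steinWitness`. [folklore] -/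
theorem stub_cruxOfSteinWitness :
    (∃ b C : ℝ, 3 - 3 * Real.logb 2 (1 + Real.sqrt 2) / (2 + Real.logb 2 (1 + Real.sqrt 2)) < b ∧
      b ≤ 2 ∧ 0 < C ∧
      ∀ r : ℕ, 1 ≤ r → ∃ (K : Finset (Site 3)) (A : SpinConfig (Site 3) → ℝ),
        (0 : Site 3) ∉ K ∧ DependsOn A (↑K : Set (Site 3)) ∧
        0 < plusExpect 3 (criticalBeta 3) 0 (fun σ => A σ *
            (1 - Real.tanh (criticalBeta 3 * ∑ y ∈ (zdGraph 3).neighborFinset 0, spinAt y σ) ^ 2)) ∧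
        plusExpect 3 (criticalBeta 3) 0 (fun σ => (∑ x ∈ box 3 r, A (fun y => σ (y + x)) *
            (spinAt x σ - Real.tanh (criticalBeta 3 *
              ∑ y ∈ (zdGraph 3).neighborFinset x, spinAt y σ))) ^ 2) ≤
          C * (#(box 3 r) : ℝ) * (r : ℝ) ^ (-b) *
            plusExpect 3 (criticalBeta 3) 0 (fun σ => A σ *
              (1 - Real.tanh (criticalBeta 3 *
                ∑ y ∈ (zdGraph 3).neighborFinset 0, spinAt y σ) ^ 2)) ^ 2) →
    SubPtolemyFloor := by
  rintro ⟨b, C, hb, hb2, hC, hW⟩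
  exact subPtolemyFloor_of_steinWitness hb hb2 hC hW

/-- **The crux-exact branch: Stein witnesses with `b > 3 − L` plus axial doubling give the crux.**
If `⟨σ₀σ_{2n e₁}⟩_{β_c} ≥ κ ⟨σ₀σ_{n e₁}⟩_{β_c}` for all `n ≥ 1` with some `κ > 1/8`, then witnesses with
ANY `b > 3 − L` (`= 1.728`; instead of `3 − 3L/(2+L) = 1.834`) suffice: the integrated floor `χ_n ≥ c n^b`
meets certificate C2 `SubPtolemyFloorSketch.stub_cruxOfDoublingSusceptibilityFloor` (`a₀ = 3 − b < L`,
lossless under doubling). Both antecedents are open. [folklore] -/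
theorem subPtolemyFloor_of_steinWitness_of_doubling {b C κ : ℝ}
    (hb : 3 - Real.logb 2 (1 + Real.sqrt 2) < b) (hC : 0 < C) (hκ : 1 / 8 < κ)
    (hD : ∀ n : ℕ, 1 ≤ n →
      κ * criticalTwoPoint 3 ((n : ℤ) • (Pi.single 0 1 : Site 3)) ≤
        criticalTwoPoint 3 (((2 * n : ℕ) : ℤ) • (Pi.single 0 1 : Site 3)))
    (hW : ∀ r : ℕ, 1 ≤ r → ∃ (K : Finset (Site 3)) (A : SpinConfig (Site 3) → ℝ),
        (0 : Site 3) ∉ K ∧ DependsOn A (↑K : Set (Site 3)) ∧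
        0 < plusExpect 3 (criticalBeta 3) 0 (fun σ => A σ *
            (1 - Real.tanh (criticalBeta 3 * ∑ y ∈ (zdGraph 3).neighborFinset 0, spinAt y σ) ^ 2)) ∧
        plusExpect 3 (criticalBeta 3) 0 (fun σ => (∑ x ∈ box 3 r, A (fun y => σ (y + x)) *
            (spinAt x σ - Real.tanh (criticalBeta 3 *
              ∑ y ∈ (zdGraph 3).neighborFinset x, spinAt y σ))) ^ 2) ≤
          C * (#(box 3 r) : ℝ) * (r : ℝ) ^ (-b) *
            plusExpect 3 (criticalBeta 3) 0 (fun σ => A σ *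
              (1 - Real.tanh (criticalBeta 3 *
                ∑ y ∈ (zdGraph 3).neighborFinset 0, spinAt y σ) ^ 2)) ^ 2) :
    SubPtolemyFloor := by
  obtain ⟨c, hc, hB⟩ := boxPairFloor_of_steinWitness hC hW
  have hL32 : Real.logb 2 (1 + Real.sqrt 2) < 3 / 2 := by
    rw [Real.logb_lt_iff_lt_rpow one_lt_two (by positivity)]
    have h2 : (2 : ℝ) ^ ((3 : ℝ) / 2) = 2 * Real.sqrt 2 := by
      rw [show ((3 : ℝ) / 2) = 1 + 1 / 2 by norm_num, Real.rpow_add two_pos, Real.rpow_one,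
        Real.sqrt_eq_rpow]
    rw [h2]
    have h : (1 : ℝ) < Real.sqrt 2 := by
      rw [Real.lt_sqrt zero_le_one]; norm_num
    linarith
  have hs : (3 : ℝ) ≤ 3 + b := by linarith
  obtain ⟨c', hc', hS⟩ :=
    SubPtolemyFloorSketch.stub_susceptibilityFloorOfBoxPairFloor (3 + b) hs ⟨c, hc, hB⟩
  refine SubPtolemyFloorSketch.stub_cruxOfDoublingSusceptibilityFloor ⟨κ, 3 - b, hκ, by linarith, hD,
    c', hc', ?_⟩
  intro n hn
  have h := hS n hn
  have he : (3 : ℝ) - (6 - (3 + b)) = 3 - (3 - b) := by ring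
  rw [he] at h
  exact h

/-! ### The window in which the engine is asked: `b > 2` is impossible (infrared bound) -/

/-- **Upper bound on the pair sum from the infrared bound**: `B(r) = Σ_{x,y∈Λ_r} G(y−x) ≤ K r⁵` for all
`r ≥ 1` (`B(r) ≤ |Λ_r| χ_{2r}`, `boxPair_pairSum_le`, and `χ_k ≤ 1 + B₀ k²` from the infrared bound,
`floorOfSusceptibilityFloor_sum_box_le_quadratic`). [folklore] -/
theorem pairSum_le_rpow_five : ∃ K : ℝ, 0 < K ∧ ∀ r : ℕ, 1 ≤ r →
    ∑ x ∈ box 3 r, ∑ y ∈ box 3 r, criticalTwoPoint 3 (y - x) ≤ K * (r : ℝ) ^ (5 : ℝ) := by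
  obtain ⟨B₀, hB₀, hbox⟩ := SubPtolemyFloorSketch.floorOfSusceptibilityFloor_sum_box_le_quadratic
  refine ⟨27 * (1 + 4 * B₀), by positivity, fun r hr => ?_⟩
  have hr1 : (1 : ℝ) ≤ r := by exact_mod_cast hr
  have h1 := SubPtolemyFloorSketch.boxPair_pairSum_le 3 r
  have h2 := hbox (2 * r)
  have hcard : (((2 * r + 1 : ℕ) : ℝ)) ^ 3 ≤ 27 * (r : ℝ) ^ 3 := by
    push_cast
    nlinarith [pow_le_pow_left₀ (by positivity : (0 : ℝ) ≤ 2 * r + 1)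
      (show (2 * (r : ℝ) + 1) ≤ 3 * r by linarith) 3]
  have hchi : 1 + B₀ * (((2 * r : ℕ) : ℝ)) ^ 2 ≤ (1 + 4 * B₀) * (r : ℝ) ^ 2 := by
    push_cast
    nlinarith [one_le_pow₀ (M₀ := ℝ) hr1 (n := 2)]
  have hchi0 : 0 ≤ ∑ y ∈ box 3 (2 * r), criticalTwoPoint 3 y :=
    Finset.sum_nonneg fun y _ => criticalTwoPoint_nonneg' y
  have h5 : (r : ℝ) ^ (5 : ℝ) = (r : ℝ) ^ 3 * (r : ℝ) ^ 2 := by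
    rw [show (5 : ℝ) = ((5 : ℕ) : ℝ) by norm_num, Real.rpow_natCast]; ring
  calc ∑ x ∈ box 3 r, ∑ y ∈ box 3 r, criticalTwoPoint 3 (y - x)
      ≤ (((2 * r + 1 : ℕ) : ℝ)) ^ 3 * ∑ y ∈ box 3 (2 * r), criticalTwoPoint 3 y := h1
    _ ≤ (27 * (r : ℝ) ^ 3) * ((1 + 4 * B₀) * (r : ℝ) ^ 2) :=
        mul_le_mul hcard (h2.trans hchi) hchi0 (by positivity)
    _ = 27 * (1 + 4 * B₀) * (r : ℝ) ^ (5 : ℝ) := by rw [h5]; ring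

/-- **The engine is asked exactly on `(3 − 3L/(2+L), 2]`: Stein witnesses with `b > 2` do not exist.**
If witnesses with `V_A(r) ≤ C |Λ_r| r^{-b} c_A²` existed at every scale with `b > 2`, the Cramér–Rao
floor would give `B(r) ≥ C⁻¹ r^{3+b}` (`boxPairFloor_of_steinWitness`), contradicting the infrared
bound `B(r) ≤ K r⁵` (`pairSum_le_rpow_five`). Equivalently: every Stein field has block variance
`V_A(r) ≥ c |Λ_r| r^{-2} c_A²` along a subsequence — the Stein-mass form of `χ_n ≤ C n²`. [folklore] -/
theorem steinWitness_false_of_two_lt {b C : ℝ} (hb : 2 < b) (hC : 0 < C) :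
    ¬ (∀ r : ℕ, 1 ≤ r → ∃ (K : Finset (Site 3)) (A : SpinConfig (Site 3) → ℝ),
        (0 : Site 3) ∉ K ∧ DependsOn A (↑K : Set (Site 3)) ∧
        0 < plusExpect 3 (criticalBeta 3) 0 (fun σ => A σ *
            (1 - Real.tanh (criticalBeta 3 * ∑ y ∈ (zdGraph 3).neighborFinset 0, spinAt y σ) ^ 2)) ∧
        plusExpect 3 (criticalBeta 3) 0 (fun σ => (∑ x ∈ box 3 r, A (fun y => σ (y + x)) *
            (spinAt x σ - Real.tanh (criticalBeta 3 *
              ∑ y ∈ (zdGraph 3).neighborFinset x, spinAt y σ))) ^ 2) ≤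
          C * (#(box 3 r) : ℝ) * (r : ℝ) ^ (-b) *
            plusExpect 3 (criticalBeta 3) 0 (fun σ => A σ *
              (1 - Real.tanh (criticalBeta 3 *
                ∑ y ∈ (zdGraph 3).neighborFinset 0, spinAt y σ) ^ 2)) ^ 2) := by
  intro hW
  obtain ⟨c, hc, hB⟩ := boxPairFloor_of_steinWitness hC hW
  obtain ⟨K, hK, hup⟩ := pairSum_le_rpow_five
  -- `c r^{3+b} ≤ K r^5`, i.e. `r^{b-2} ≤ K/c`, for all `r ≥ 1`: impossible for `b > 2`
  have hev : ∀ᶠ r : ℕ in Filter.atTop, K / c < (r : ℝ) ^ (b - 2) :=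
    ((tendsto_rpow_atTop (by linarith : 0 < b - 2)).comp tendsto_natCast_atTop_atTop).eventually_gt_atTop
      (K / c)
  obtain ⟨r, hr1, hr⟩ := ((Filter.eventually_ge_atTop 1).and hev).exists
  have hr0 : (0 : ℝ) < r := Nat.cast_pos.2 hr1
  have h := (hB r hr1).trans (hup r hr1)
  have hsplit : (r : ℝ) ^ (3 + b) = (r : ℝ) ^ (5 : ℝ) * (r : ℝ) ^ (b - 2) := by
    rw [← Real.rpow_add hr0]; congr 1; ring
  rw [hsplit] at h
  have h5 : 0 < (r : ℝ) ^ (5 : ℝ) := Real.rpow_pos_of_pos hr0 _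
  have h' : c * (r : ℝ) ^ (b - 2) ≤ K := by
    have := h
    nlinarith [mul_le_mul_of_nonneg_left this (inv_nonneg.2 h5.le), inv_mul_cancel₀ h5.ne']
  rw [div_lt_iff₀ hc] at hr
  linarith [mul_comm c ((r : ℝ) ^ (b - 2))]

end Summit.CriticalPhenomena.Ising3DConformalLimit.SubPtolemyFloorStein

end
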